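import Mathlib
import Literature.Barriers.ValiantsHypothesis.PartialDerivativesDetPerm
import Literature.Barriers.ValiantsHypothesis.ShiftedPartialsMonotone

/-!
# Crux `WordLengthQP` (stmt-ValiantsHypothesis-6623), line `Sketch` (eps-order-ladder) —
stub `stub_spRank_sum_le`

Sub-additivity of the method of partial derivatives (Nisan–Wigderson 1996, §2): the dimension of
the span of the `k`-th order iterated partial derivatives of a finite linear combination
`∑_{i ∈ s} c_i · f_i` is at most the sum over `i ∈ s` of the dimensions for the `f_i`.  The
measure is the tree's `shiftedPartialsRank K k 0` (shift `τ = 0` of the shifted partials of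
`ShiftedPartialDerivatives.lean`, i.e. the flattening rank of `PartialDerivativesDetPerm.lean`,
`shiftedPartialsRank_zero_eq`).  Proof: a `k`-th derivative of the combination is the same
combination of the `k`-th derivatives (`iterPDeriv_sum`, `iterPDeriv_smul`), so the span lies in
the finite supremum of the spans, whose dimension is at most the sum of the dimensions
(`finrank_finset_sup_le_sum`).

## References

* [NisanWigderson1996] N. Nisan, A. Wigderson, *Lower bounds on arithmetic circuits via partial
  derivatives*, Comput. Complexity 6 (1996) 217–234, §2.
-/

-- `Summit.ValiantsHypothesis.ValiantsHypothesis.…` is the tree's mandated single-conjunct layout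
-- (Sub = Summit), so the duplicated namespace component is intended.
set_option linter.dupNamespace false

noncomputable section

open MvPolynomial

namespace Summit.ValiantsHypothesis.ValiantsHypothesis.Cruxes.WordLengthQP.EpsOrderLadder

open Literature.Barriers.ValiantsHypothesis

/-- The `k`-th order partials of `∑_{i ∈ s} C (c i) * f i` lie in the supremum over `i ∈ s` of the
spans of the `k`-th order partials of the `f i`. [folklore] -/
theorem spRankSum_span_derivSet_sum_le {K : Type} [Field K] {σ : Type} {ι : Type} (s : Finset ι)
    (c : ι → K) (f : ι → MvPolynomial σ K) (k : ℕ) :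
    Submodule.span K (derivSet k (∑ i ∈ s, MvPolynomial.C (c i) * f i)) ≤
      s.sup fun i => Submodule.span K (derivSet k (f i)) := by
  rw [Submodule.span_le]
  rintro _ ⟨l, hl, rfl⟩
  rw [iterPDeriv_sum]
  refine Submodule.sum_mem _ fun i hi => ?_
  rw [MvPolynomial.C_mul', iterPDeriv_smul]
  exact Submodule.smul_mem _ _
    (Finset.le_sup (f := fun i => Submodule.span K (derivSet k (f i))) hi
      (Submodule.subset_span ⟨l, hl, rfl⟩))

/-- **stub_spRank_sum_le** (sub-additivity of the method of partial derivatives): the flattening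
rank `shiftedPartialsRank K k 0` of a finite linear combination `∑_{i ∈ s} C (c i) * f i` is at
most the sum of the flattening ranks of the `f i`. [cite: NisanWigderson1996, §2] [folklore] -/
theorem stub_spRank_sum_le {K : Type} [Field K] {σ : Type} [Fintype σ] [DecidableEq σ]
    {ι : Type} (s : Finset ι) (c : ι → K) (f : ι → MvPolynomial σ K) (k : ℕ) :
    Literature.Barriers.ValiantsHypothesis.shiftedPartialsRank K k 0
        (∑ i ∈ s, MvPolynomial.C (c i) * f i) ≤
      ∑ i ∈ s, Literature.Barriers.ValiantsHypothesis.shiftedPartialsRank K k 0 (f i) := by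
  haveI : ∀ i, Module.Finite K (Submodule.span K (derivSet k (f i))) := fun i => by
    rw [← shiftedPartials_zero_right]; exact finite_span_shiftedPartials k 0 (f i)
  rw [shiftedPartialsRank_zero_eq]
  calc Module.finrank K (Submodule.span K (derivSet k (∑ i ∈ s, MvPolynomial.C (c i) * f i)))
      ≤ Module.finrank K ↥(s.sup fun i => Submodule.span K (derivSet k (f i))) :=
        Submodule.finrank_mono (spRankSum_span_derivSet_sum_le s c f k)
    _ ≤ ∑ i ∈ s, Module.finrank K (Submodule.span K (derivSet k (f i))) :=
        finrank_finset_sup_le_sum s _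
    _ = ∑ i ∈ s, shiftedPartialsRank K k 0 (f i) :=
        Finset.sum_congr rfl fun i _ => (shiftedPartialsRank_zero_eq K k (f i)).symm

end Summit.ValiantsHypothesis.ValiantsHypothesis.Cruxes.WordLengthQP.EpsOrderLadder

end
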